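import Summits.CriticalPhenomena.PercolationContinuityZ3.Theorems.PercNearOneGluingNoHeavyLowerTailKnQuestion8CoefficientwiseOneSidedCell
import HarnessLib

/-!
# Conjecture RZ-OS (one-sided restricted kernel) for a pendant conditioning vertex (prim-lf-2 gen 30)

Support file (`--supports stmt-CriticalPhenomena-4575`, closed), prover `prim-lf-2` (gen 30).  No definitions, no named facts, no sorries; standard axioms.
Memo `prim-lf-2/CW-ROOT-gen30.md` §6b; companions `…CoefficientwiseOneSidedCell.lean` (one-sided cell lemma and off-cluster theorem),
`…CoefficientwiseOffClusterPred.lean` (p263680: the two-sided `rz_pendant` and the leaf lemmas).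

* `Coefficientwise.rz_os_pendant` — for a leaf `z ≠ x` (pendant edge `e₀ = {z,v}`, `z ≠ v`), a vertex `a ≠ z`, a vertex set `A′ ∌ z`, monotone `f ≥ 0` and
  monotone `g`:  `0 ≤ Σ_{s : z ∉ C_x(s), z ∉ C_x(sᶜ), a ∈ C_z(s), A′ ∩ (C_z(s) ∪ C_z(sᶜ)) = ∅} f(C_x sᶜ)·(g(C_x sᶜ) − g(C_x s))` — on `{a ∈ C_z(red)}` the blue
  cluster of `x` dominates the red one even after tilting by an increasing nonnegative function of the blue cluster (`f ≡ 1`: DOM-A for pendant `z`).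
  Proof: only `e₀ ∈ s` contributes; then `C_z(s) = {z} ∪ C_v(s ∖ e₀)`, `C_z(sᶜ) = {z}`, and the sum is `offCluster_oneSided_nonneg_pred_sub` on `E ∖ e₀`
  with `A = {v}`, `P(R) = (a ∈ R ∧ A′ ∩ R = ∅)`.
[cite: KozmaNitzan2024, Questions 8–9 (§5.5 p. 36) (context: first rung of the coefficientwise programme for Question 8)]
-/

namespace Summit.CriticalPhenomena.PercolationContinuityZ3.Theorems

open Finset Literature.Probability.Percolation

namespace Coefficientwise

variable {ι V : Type*}

section pendant
variable [Fintype ι] [DecidableEq ι]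

open Classical in
/-- **Conjecture RZ-OS (one-sided RZ) holds for a pendant conditioning vertex** (prim-lf-2 gen 30, memo CW-ROOT-gen30 §6b).  Let `z ≠ x` be a leaf (`e₀ = {z,v}` its only edge,
`z ≠ v`), `a ≠ z` a vertex and `A′ ∌ z` a vertex set.  Then the first-rung kernel of `(E; x, z)` restricted to the `z`-side event
`{a ∈ C_z(red)} ∩ {A′ meets neither C_z(red) nor C_z(blue)}` satisfies the blue-primary one-sided inequality: for monotone `f ≥ 0` and monotone `g`,
  `0 ≤ Σ_{s : z ∉ C_x(s), z ∉ C_x(sᶜ), a ∈ C_z(s), A′ ∩ (C_z(s) ∪ C_z(sᶜ)) = ∅} f(C_x sᶜ)·(g(C_x sᶜ) − g(C_x s))`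
(with `f ≡ 1`: on `{a ∈ C_z(red)}` the blue cluster of `x` dominates the red one — DOM-A for pendant `z`).  Proof as `rz_pendant`, ending in
`offCluster_oneSided_nonneg_pred_sub`.  [cite: KozmaNitzan2024, Questions 8–9 (§5.5 p. 36) (context)] -/
theorem rz_os_pendant (ends : ι → Sym2 V) {z v x : V} {e₀ : ι} (he₀ : ends e₀ = s(z, v))
    (hpend : ∀ i, z ∈ ends i → i = e₀) (hzx : z ≠ x) (hzv : z ≠ v) {a : V} (haz : a ≠ z) (A' : Set V) (hzA : z ∉ A')
    (f g : Set V → ℝ) (hf : Monotone f) (hf0 : ∀ W, 0 ≤ f W) (hg : Monotone g) :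
    0 ≤ ∑ s ∈ univ.filter (fun s : Finset ι =>
        z ∉ openCluster (ends '' (↑s : Set ι)) x ∧ z ∉ openCluster (ends '' (↑(sᶜ) : Set ι)) x ∧
          a ∈ openCluster (ends '' (↑s : Set ι)) z ∧
          ∀ a' ∈ A', a' ∉ openCluster (ends '' (↑s : Set ι)) z ∧ a' ∉ openCluster (ends '' (↑(sᶜ) : Set ι)) z),
      f (openCluster (ends '' (↑(sᶜ) : Set ι)) x) *
        (g (openCluster (ends '' (↑(sᶜ) : Set ι)) x) - g (openCluster (ends '' (↑s : Set ι)) x)) := by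
  set K : Finset ι → Set V := fun s => openCluster (ends '' (↑s : Set ι)) x with hK
  set Cz : Finset ι → Set V := fun s => openCluster (ends '' (↑s : Set ι)) z with hCz
  set Cv : Finset ι → Set V := fun s => openCluster (ends '' (↑s : Set ι)) v with hCv
  set E' : Finset ι := univ.erase e₀ with hE'
  set Φ' : Finset ι → ℝ := fun t => f (K (E' \ t)) * (g (K (E' \ t)) - g (K t)) with hΦ'
  change 0 ≤ ∑ s ∈ univ.filter (fun s : Finset ι => z ∉ K s ∧ z ∉ K sᶜ ∧ a ∈ Cz s ∧ ∀ a' ∈ A', a' ∉ Cz s ∧ a' ∉ Cz sᶜ),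
    f (K sᶜ) * (g (K sᶜ) - g (K s))
  have he₀E' : e₀ ∉ E' := fun h => (Finset.mem_erase.mp h).1 rfl
  have huniv : (univ : Finset (Finset ι)) = (insert e₀ E').powerset := by
    rw [hE', Finset.insert_erase (Finset.mem_univ e₀), Finset.powerset_univ]
  -- the predicate off-cluster sum on `G − e₀`
  have hbase : 0 ≤ ∑ t ∈ E'.powerset.filter (fun t : Finset ι => v ∉ K t ∧ (a ∈ Cv t ∧ ∀ a' ∈ A', a' ∉ Cv t)), Φ' t := by
    have := offCluster_oneSided_nonneg_pred_sub ends E' x ({v} : Set V)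
      (fun R : Set V => a ∈ R ∧ ∀ a' ∈ A', a' ∉ R) f g hf hf0 hg
    have hset : ∀ t : Finset ι, {y | ∃ b ∈ ({v} : Set V), y ∈ openCluster (ends '' (↑t : Set ι)) b} = Cv t := by
      intro t; ext y; simp [hCv]
    simpa [hK, hΦ', hset] using this
  have compl_of_sub : ∀ t, t ⊆ E' → tᶜ = insert e₀ (E' \ t) := by
    intro t ht
    ext i
    simp only [Finset.mem_compl, Finset.mem_insert, Finset.mem_sdiff, hE', Finset.mem_erase, Finset.mem_univ, and_true]
    constructor
    · intro hi
      by_cases hie : i = e₀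
      · exact Or.inl hie
      · exact Or.inr ⟨hie, hi⟩
    · rintro (rfl | ⟨_, hi⟩)
      · exact fun h => he₀E' (ht h)
      · exact hi
  have compl_insert_of_sub : ∀ t, t ⊆ E' → (insert e₀ t)ᶜ = E' \ t := by
    intro t ht
    ext i
    simp only [Finset.mem_compl, Finset.mem_insert, Finset.mem_sdiff, hE', Finset.mem_erase, Finset.mem_univ, and_true, not_or]
  have notin_of_sub : ∀ t, t ⊆ E' → e₀ ∉ t := fun t ht h => he₀E' (ht h)
  have notin_sdiff : ∀ t, e₀ ∉ E' \ t := fun t h => he₀E' (Finset.mem_sdiff.mp h).1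
  rw [Finset.sum_filter, huniv, Finset.sum_powerset_insert he₀E']
  -- first half: `e₀` blue, `C_z(t) = {z}` so `a ∉ C_z(t)`: every term vanishes
  have h1 : ∑ t ∈ E'.powerset, (if z ∉ K t ∧ z ∉ K tᶜ ∧ a ∈ Cz t ∧ ∀ a' ∈ A', a' ∉ Cz t ∧ a' ∉ Cz tᶜ then
      f (K tᶜ) * (g (K tᶜ) - g (K t)) else 0) = 0 := by
    refine Finset.sum_eq_zero fun t ht => ?_
    have hsub : t ⊆ E' := Finset.mem_powerset.mp ht
    have ha : a ∉ Cz t := fun h => haz ((mem_openCluster_leaf_iff_eq ends hpend (notin_of_sub t hsub) a).mp h)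
    simp [ha]
  -- second half: `e₀` red
  have h2 : ∑ t ∈ E'.powerset, (if z ∉ K (insert e₀ t) ∧ z ∉ K (insert e₀ t)ᶜ ∧ a ∈ Cz (insert e₀ t) ∧
        ∀ a' ∈ A', a' ∉ Cz (insert e₀ t) ∧ a' ∉ Cz (insert e₀ t)ᶜ then
        f (K (insert e₀ t)ᶜ) * (g (K (insert e₀ t)ᶜ) - g (K (insert e₀ t))) else 0) =
      ∑ t ∈ E'.powerset, (if v ∉ K t ∧ (a ∈ Cv t ∧ ∀ a' ∈ A', a' ∉ Cv t) then Φ' t else 0) := by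
    refine Finset.sum_congr rfl fun t ht => ?_
    have hsub : t ⊆ E' := Finset.mem_powerset.mp ht
    have ht0 : e₀ ∉ t := notin_of_sub t hsub
    rw [compl_insert_of_sub t hsub]
    have hzc : z ∉ K (E' \ t) := leaf_not_mem_openCluster ends hpend hzx (notin_sdiff t)
    have hCz1 : ∀ y, y ∈ Cz (insert e₀ t) ↔ y = z ∨ y ∈ Cv t := fun y =>
      mem_openCluster_leaf_insert_iff ends he₀ hpend ht0 y
    have hCz2 : ∀ y, y ∈ Cz (E' \ t) ↔ y = z := fun y => mem_openCluster_leaf_iff_eq ends hpend (notin_sdiff t) y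
    have ha1 : a ∈ Cz (insert e₀ t) ↔ a ∈ Cv t := by rw [hCz1]; simp [haz]
    have hA1 : (∀ a' ∈ A', a' ∉ Cz (insert e₀ t) ∧ a' ∉ Cz (E' \ t)) ↔ (∀ a' ∈ A', a' ∉ Cv t) := by
      refine forall₂_congr fun a' ha' => ?_
      have ha'z : a' ≠ z := fun h => hzA (h ▸ ha')
      rw [hCz1, hCz2]; simp [ha'z]
    by_cases hv : v ∈ K t
    · have hz : z ∈ K (insert e₀ t) := (leaf_mem_openCluster_insert_iff ends he₀ hpend hzx hzv ht0).mpr hv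
      simp [hz, hv]
    · have hKi : K (insert e₀ t) = K t := openCluster_insert_pendant ends he₀ hpend hzx ht0 hv
      have hzt : z ∉ K t := leaf_not_mem_openCluster ends hpend hzx ht0
      rw [hKi, ha1, hA1]
      simp [hzt, hzc, hv, hΦ']
  rw [h1, h2, zero_add, ← Finset.sum_filter]
  exact hbase

end pendant

end Coefficientwise

end Summit.CriticalPhenomena.PercolationContinuityZ3.Theorems
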